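import Literature.Probability.Percolation.ArmSeparationFrame
import Literature.Probability.Percolation.TriHalfAnnulus
import HarnessLib

/-!
# The fence of the lowest crossing at an INTERNAL extremity (twin of `ArmSeparationFrame.lean`)

Topic: Probability / Percolation; family `crit-perc`. A brick of the discharge of
`Literature.Probability.Percolation.Nolin2008_twoArm_separation` (Nolin 2008, Thm. 11 [arXiv 0711.4948: Thm. 10],
`j = 2`; `ArmSeparation.lean`). `ArmSeparationFrame.lean` proves the deterministic core of the
separation step at an EXTERNAL extremity: an open frame `triFrameAt z k` about the tip `z` of an
open crossing `c` of the boundary trapezoid `trapDomain M`, present in any configuration agreeing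
with `ω` off `lower c z`, yields in `ω` a fence outside `Λ_{2M}` joined to `c`
(`trap_exists_fence`) and forbids closed escapes from top-type sites near the tip
(`trap_no_closed_escape`). This file is the word-for-word twin for an INTERNAL extremity
(Nolin 2008, §4.4, "2. Internal extremities: the reasoning is the same … from `∂S_{2^k}` toward the
interior"), on the inner half-annulus `HalfAnnulus.intDom m` of `TriHalfAnnulus.lean` (tips on the
inner side `1` of `∂Λ_m`, `z = (m, t)`), where the roles of "outside `Λ_{2M}`" are played by the
inner half-hexagon `HalfAnnulus.hinSet m = {0 ≤ x₀, |x|_𝕋 < m}` and the fence lies INSIDE `Λ_m`: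

* `int_no_closed_escape` — no closed `𝕋`-path of the half-annulus joins a top-type site
  (`Tp ∪ J_{>z}`) inside the inner box of the frame to a site outside its outer box;
* `int_exists_fence` — for tips at distance `> 2k` from both ends of the side
  (`-m + 2k + 1 ≤ t ≤ -(2k+1)`; tips closer to a corner of `∂Λ_m` are handled by corner protection
  in the probabilistic part): the box `[m-2k, m-k] × [t+k, t+2k]` (inside `Λ̊_m`) is crossed
  vertically by `ω`-open sites through a site `mm`, and `mm` is joined to a site of `c` by an
  `ω`-open path of the zone `intFrameZone m z k` (sites of the half-annulus, and sites of the inner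
  half-hexagon strictly above the row of the tip, within the square of half-width `2k+1` about
  `z`). This is Nolin's inner free space "included in `S_n`" (§4.2, after Def. 7) for the arm
  that meets `c`.

The proofs are those of the twin file with `W ↔ E` exchanged: the left crossing of the frame lies
in the inner half-hexagon, the union `Y = N ∪ S ∪ E` of the other three is met by `c`, and along
`Y ∖ c` from the meeting point `mm` of `N` with the fence one propagates the invariant "in the
half-annulus: `above c z`; in the inner half-hexagon: strictly above the row of the tip"
(`int_invariant_step`), using that a half-annulus site next to an inner site is on the inner
boundary, where top-type / bottom-type is read off the coordinates, and that `above` contains no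
bottom-type site (`JDomain.IsCrossing.not_mem_above_of_mem_Bt_union`, `HalfAnnulus.intDom_cutProp`).

## References

* P. Nolin, *Near-critical percolation in two dimensions*, EJP 13 (2008), §4.2 (Def. 6–7, free
  spaces on the internal boundary), §4.4 (proof of Thm. 11, internal extremities; Lemma 15)
  [arXiv 0711.4948: Def. 6–7, Thm. 10, Lemma 14]. [Nolin2008]
* H. Kesten, *Scaling relations for 2D-percolation*, Comm. Math. Phys. 109 (1987), Lemma 2. [Kesten1987]

Tree: `triFrameAt`, `FrameData` and its API (`ArmSeparationFrame.lean`), `HalfAnnulus.intDom`,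
`intDom_cutProp`, `haSet`, `hinSet` (`TriHalfAnnulus.lean`), `JDomain` calculus
(`TriLowestCrossing.lean`), `PathIn.exists_slab_crossing` (`TriPathCrossings.lean`),
`PathIn.tri_crossings_meet` (`TriCrossingsMeet.lean`), `OpenVCrossThrough` (`ArmSeparation.lean`),
`triNorm_le_triNorm_add_one_of_adj` (`ArmEventsProofs.lean`).
-/

noncomputable section

open Set

namespace Literature.Probability.Percolation

open LatticeModels HalfAnnulus

/-! ### More frame bookkeeping: the union of the top, bottom and right crossings -/

namespace FrameData

variable {z : Site 2} {k : ℕ} {ω : SiteConfig (Site 2)} (F : FrameData z k ω)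

/-- The union of the top, bottom and right crossings (those that may enter the half-annulus at an
internal extremity). [folklore] -/
def Yr : Set (Site 2) := F.SN ∪ F.SS ∪ F.SE

/-- `Yr ⊆ K`. [folklore] -/
theorem Yr_subset_K : F.Yr ⊆ F.K := by
  rintro v ((hv | hv) | hv)
  · exact Or.inl (Or.inl (Or.inl hv))
  · exact Or.inl (Or.inl (Or.inr hv))
  · exact Or.inr hv

/-- The top and right crossings meet. [cite: KestenPTM1982, §2.2 (paths crossing a rectangle must intersect)] -/
theorem exists_mem_SN_SE (hk : 1 ≤ k) : ∃ p, p ∈ F.SN ∧ p ∈ F.SE := by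
  have hk' : (1 : ℤ) ≤ k := by exact_mod_cast hk
  exact PathIn.tri_crossings_meet (L := z 0 - 2 * k) (R := z 0 + 2 * k) (B := z 1 - 2 * k) (T := z 1 + 2 * k)
    (fun v hv => by have := F.boundsN hv; omega) (fun v hv => by have := F.boundsE hv; omega)
    F.pathN F.xN0 F.yN0 F.pathE F.xE1 F.yE1

/-- The bottom and right crossings meet. [cite: KestenPTM1982, §2.2 (paths crossing a rectangle must intersect)] -/
theorem exists_mem_SS_SE (hk : 1 ≤ k) : ∃ p, p ∈ F.SS ∧ p ∈ F.SE := by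
  have hk' : (1 : ℤ) ≤ k := by exact_mod_cast hk
  exact PathIn.tri_crossings_meet (L := z 0 - 2 * k) (R := z 0 + 2 * k) (B := z 1 - 2 * k) (T := z 1 + 2 * k)
    (fun v hv => by have := F.boundsS hv; omega) (fun v hv => by have := F.boundsE hv; omega)
    F.pathS F.xS0 F.yS0 F.pathE F.xE1 F.yE1

/-- `Yr` is connected: any two of its sites are joined inside `Yr`. [folklore] -/
theorem pathIn_Yr (hk : 1 ≤ k) {u v : Site 2} (hu : u ∈ F.Yr) (hv : v ∈ F.Yr) : PathIn triGraph F.Yr u v := by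
  suffices h : ∀ w ∈ F.Yr, PathIn triGraph F.Yr F.xN w from (h u hu).symm.trans (h v hv)
  obtain ⟨p₁, hp₁N, hp₁E⟩ := F.exists_mem_SN_SE hk
  obtain ⟨p₂, hp₂S, hp₂E⟩ := F.exists_mem_SS_SE hk
  have hNY : F.SN ⊆ F.Yr := fun _ h => Or.inl (Or.inl h)
  have hSY : F.SS ⊆ F.Yr := fun _ h => Or.inl (Or.inr h)
  have hEY : F.SE ⊆ F.Yr := fun _ h => Or.inr h
  have toE : ∀ w ∈ F.SE, PathIn triGraph F.Yr F.xN w := fun w hw =>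
    ((F.tightN p₁ hp₁N).mono hNY).trans
      (((F.tightE p₁ hp₁E).symm.trans (F.tightE w hw)).mono hEY)
  intro w hw
  rcases hw with (hw | hw) | hw
  · exact (F.tightN w hw).mono hNY
  · exact (toE p₂ hp₂E).trans (((F.tightS p₂ hp₂S).symm.trans (F.tightS w hw)).mono hSY)
  · exact toE w hw

end FrameData

/-! ### The zone and the fence of an open crossing of the inner half-annulus -/

/-- **The zone of the inner fence construction** about the tip `z` at scale `k`: the sites of the
half-annulus, and the sites of the inner half-hexagon strictly above the row of `z`, inside the
square of half-width `2k + 1` about `z` (Nolin 2008, §4.2, after Def. 7: free spaces on the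
internal boundary are "included in `S_n`"). [cite: Nolin2008, §4.2 Def. 6–7 (free spaces on the internal boundary) (arXiv 0711.4948)] -/
def intFrameZone (m : ℕ) (z : Site 2) (k : ℕ) : Set (Site 2) :=
  {v | (v ∈ haSet m ∨ (v ∈ hinSet m ∧ z 1 < v 1)) ∧
    z 0 - (2 * k + 1) ≤ v 0 ∧ v 0 ≤ z 0 + (2 * k + 1) ∧ z 1 - (2 * k + 1) ≤ v 1 ∧ v 1 ≤ z 1 + (2 * k + 1)}

/-- Membership in the inner zone, unfolded. [folklore] -/
theorem mem_intFrameZone {m k : ℕ} {z v : Site 2} :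
    v ∈ intFrameZone m z k ↔ (v ∈ haSet m ∨ (v ∈ hinSet m ∧ z 1 < v 1)) ∧
      z 0 - (2 * k + 1) ≤ v 0 ∧ v 0 ≤ z 0 + (2 * k + 1) ∧ z 1 - (2 * k + 1) ≤ v 1 ∧ v 1 ≤ z 1 + (2 * k + 1) :=
  Iff.rfl

section Fence

variable {m k : ℕ} {c : Finset (Site 2)} {z : Site 2}

/-- The tip of a crossing of `intDom m` lies on the tip arc. [folklore] -/
theorem tip_isIntJ (hc : (intDom m).IsCrossing c z) : IsIntJ m z := (mem_intDom_J.1 hc.tip_mem_J).2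

/-- Sites of a crossing of `intDom m` lie in the half-annulus. [folklore] -/
theorem mem_haSet_of_mem_crossing (hc : (intDom m).IsCrossing c z) {v : Site 2} (hv : v ∈ c) : v ∈ haSet m := by
  rw [← coe_haFin]; exact Finset.mem_coe.2 (hc.subset hv)

/-- **Protection from above, for free (internal extremity).** Let `c` be a crossing of `intDom m`
with tip `z`, open in `ω`; let `ω'` agree with `ω` off `lower c z` and contain the open frame at
scale `k` about `z`. Then in `ω` no closed `𝕋`-path of the half-annulus goes from a top-type site
(`Tp ∪ J_{>z}`) inside the inner box of the frame to a site outside its outer box (it would meet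
the frame at a site open in `ω'`, closed in `ω`, hence `below c z`, while the closed path runs
inside `above c z`). Twin of `trap_no_closed_escape`. [cite: Nolin2008, §4.4 Lemma 15 (proof) (arXiv 0711.4948: Lemma 14)] -/
theorem int_no_closed_escape (hk : 1 ≤ k) (hc : (intDom m).IsCrossing c z) {ω ω' : SiteConfig (Site 2)}
    (hcω : (↑c : Set (Site 2)) ⊆ ω) (hagree : ∀ v, v ∉ (intDom m).lower c z → (v ∈ ω' ↔ v ∈ ω))
    (hframe : ω' ∈ triFrameAt z k) {q t : Site 2} (hq : q ∈ (intDom m).Tp ∪ (intDom m).Jabove z)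
    (hqin : z 0 - k ≤ q 0 ∧ q 0 ≤ z 0 + k ∧ z 1 - k ≤ q 1 ∧ q 1 ≤ z 1 + k)
    (ht : t 0 ≤ z 0 - 2 * k ∨ z 0 + 2 * k ≤ t 0 ∨ t 1 ≤ z 1 - 2 * k ∨ z 1 + 2 * k ≤ t 1)
    (hpath : PathIn triGraph (haSet m ∩ ωᶜ) q t) : False := by
  obtain ⟨F⟩ := nonempty_frameData hframe
  obtain ⟨Tq, hTq, hqt, htight⟩ := hpath.exists_support
  obtain ⟨x, hxT, hxK⟩ := F.exists_mem_K hk hqin ht hqt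
  have hxω' : x ∈ ω' := F.K_subset hxK
  have hxω : x ∉ ω := (hTq hxT).2
  have hxlow : x ∈ (intDom m).lower c z := by
    by_contra h
    exact hxω ((hagree x h).1 hxω')
  have hxc : x ∉ c := fun h => hxω (hcω h)
  have hxbelow : x ∈ (intDom m).below c z := by
    rcases JDomain.mem_lower.1 hxlow with h | h
    · exact absurd h hxc
    · exact h
  have hTq' : Tq ⊆ (↑((intDom m).D \ c) : Set (Site 2)) := by
    intro v hv
    rw [coe_intDom_D_sdiff]
    exact ⟨(hTq hv).1, fun hvc => (hTq hv).2 (hcω hvc)⟩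
  have hqc : q ∉ c := fun h => (hTq hqt.left_mem).2 (hcω h)
  have hqabove : q ∈ (intDom m).above c z := by
    rcases Finset.mem_union.1 hq with h | h
    · exact hc.mem_above_of_mem_Tp h hqc
    · exact hc.mem_above_of_mem_Jabove h
  have hxabove : x ∈ (intDom m).above c z := JDomain.mem_above_of_pathIn' hqabove ((htight x hxT).mono hTq')
  exact (JDomain.mem_below.1 hxbelow).2.2 hxabove
set_option maxHeartbeats 400000 in
/-- **Closure step of the invariant** along a `c`-avoiding path inside the union `Yr` of the top,
bottom and right crossings of a frame about the tip `z = (m, t)` of a crossing of `intDom m`, for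
`m ≥ 5`, `1 ≤ k`, `-m + 2k + 1 ≤ t ≤ -(2k+1)`: with the invariant "in the half-annulus
(`|v| ≥ m`): `above c z`; in the inner half-hexagon (`|v| < m`): strictly above the row of the tip",
if it holds at `v ∈ Yr ∖ c` it holds at every neighbour `w ∈ Yr ∖ c`. [cite: Kesten1987, Lemma 2 (lowest crossing)] -/
theorem int_invariant_step (hm : 5 ≤ m) (hk : 1 ≤ k) (hc : (intDom m).IsCrossing c z)
    (htk : -(m : ℤ) + 2 * k + 1 ≤ z 1 ∧ z 1 ≤ -(2 * (k : ℤ) + 1))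
    {ω' : SiteConfig (Site 2)} (F : FrameData z k ω') {v w : Site 2} (hv : v ∈ F.Yr \ ↑c) (hw : w ∈ F.Yr \ ↑c)
    (hadj : triGraph.Adj v w) (hvin : (m : ℤ) ≤ triNorm v → v ∈ (intDom m).above c z)
    (hvout : triNorm v < m → z 1 < v 1) :
    ((m : ℤ) ≤ triNorm w → w ∈ (intDom m).above c z) ∧ (triNorm w < m → z 1 < w 1) := by
  have hk' : (1 : ℤ) ≤ k := by exact_mod_cast hk
  have hzJ := tip_isIntJ hc
  unfold IsIntJ at hzJ
  obtain ⟨hz0, hz1, hz2⟩ := hzJ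
  have hYb : ∀ u ∈ F.Yr, z 0 - 2 * k ≤ u 0 ∧ u 0 ≤ z 0 + 2 * k ∧ z 1 - 2 * k ≤ u 1 ∧ u 1 ≤ z 1 + 2 * k :=
    fun u hu => F.boundsK (F.Yr_subset_K hu)
  -- sites of `Yr` of norm `≥ m` are in the half-annulus
  have hYD : ∀ u ∈ F.Yr, (m : ℤ) ≤ triNorm u → u ∈ haFin m := by
    intro u hu hn
    have hb := hYb u hu
    refine mem_haFin.2 ⟨by omega, hn, ?_⟩
    rw [triNorm_eq_max]; omega
  -- inner sites of `Yr` avoid the row of the tip (`N`: rows `≥ t+k`, `S`: rows `≤ t-k`, `E`: not inner)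
  have hYrow : ∀ u ∈ F.Yr, triNorm u < m → u 1 ≠ z 1 := by
    intro u hu hn
    rcases hu with (hu | hu) | hu
    · have := F.boundsN hu; omega
    · have := F.boundsS hu; omega
    · have hb := F.boundsE hu
      rw [triNorm_eq_max] at hn
      omega
  have hcoord := fun {a b : Site 2} (h : triGraph.Adj a b) => (triGraph_adj_iff_coord a b).1 h
  have hwc : w ∉ c := fun h => hw.2 (Finset.mem_coe.2 h)
  have hvc : v ∉ c := fun h => hv.2 (Finset.mem_coe.2 h)
  have hwne : w ≠ z := fun h => hwc (h ▸ hc.tip_mem)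
  have hvne : v ≠ z := fun h => hvc (h ▸ hc.tip_mem)
  have hwne' : ¬ (w 0 = z 0 ∧ w 1 = z 1) := fun h => hwne (Site.eq_iff_two.2 h)
  have hvne' : ¬ (v 0 = z 0 ∧ v 1 = z 1) := fun h => hvne (Site.eq_iff_two.2 h)
  have hN1 := triNorm_le_triNorm_add_one_of_adj hadj
  have hN2 := triNorm_le_triNorm_add_one_of_adj hadj.symm
  constructor
  · intro hwn
    have hwD : w ∈ haFin m := hYD w hw.1 hwn
    by_cases hvn : (m : ℤ) ≤ triNorm v
    · exact JDomain.mem_above_of_adj (hvin hvn) hwD hwc hadj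
    · rw [not_le] at hvn
      -- `w` is on the inner boundary, next to an inner site above the tip row: top-type
      have hvrow := hvout hvn
      have hwN : triNorm w = m := by omega
      have hvw := hcoord hadj
      have hwb := hYb w hw.1
      have hwN' := hwN
      rw [triNorm_eq_max] at hwN'
      -- coordinates: `w` on inner side 2 (`Tp`), or `w = (m, y)` with `y > t`
      have hcases : (0 ≤ w 1 ∧ w 0 + w 1 = m) ∨ (w 0 = m ∧ z 1 < w 1 ∧ w 1 ≤ 0) := by
        have hvN := hvn; rw [triNorm_eq_max] at hvN
        omega
      rcases hcases with hTp | ⟨hw0, hw1, hw1'⟩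
      · exact hc.mem_above_of_mem_Tp (mem_intDom_Tp.2 ⟨hwD, ⟨hwN, Or.inl hTp⟩⟩) hwc
      · by_cases hj : w 1 ≤ -2
        · exact hc.mem_above_of_mem_Jabove (JDomain.mem_Jabove.2
            ⟨mem_intDom_J.2 ⟨hwD, ⟨hw0, by omega, hj⟩⟩, by simpa using hw1⟩)
        · exact hc.mem_above_of_mem_Tp (mem_intDom_Tp.2 ⟨hwD, ⟨hwN, Or.inr ⟨hw0, by omega⟩⟩⟩) hwc
  · intro hwn
    have hvw := hcoord hadj
    have hne := hYrow w hw.1 hwn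
    by_cases hvn : (m : ℤ) ≤ triNorm v
    · -- `v` is an `above` site of the inner boundary: not bottom-type, hence rows `> t` next to it
      have hva := hvin hvn
      have hvD : v ∈ haFin m := hYD v hv.1 hvn
      have hvN : triNorm v = m := by omega
      have hnotBt : ¬ (v ∈ (intDom m).Bt ∪ (intDom m).Jbelow z) := fun h =>
        hc.not_mem_above_of_mem_Bt_union (intDom_cutProp hm) h hva
      have hnotBt' : ¬ (IsIntBt m v ∨ (IsIntJ m v ∧ v 1 < z 1)) := by
        rintro (h | ⟨h1, h2⟩)
        · exact hnotBt (Finset.mem_union_left _ (mem_intDom_Bt.2 ⟨hvD, h⟩))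
        · exact hnotBt (Finset.mem_union_right _ (JDomain.mem_Jbelow.2 ⟨mem_intDom_J.2 ⟨hvD, h1⟩, by simpa using h2⟩))
      unfold IsIntBt IsIntJ at hnotBt'
      have hvb := hYb v hv.1
      have hvN' := hvN
      have hwn' := hwn
      rw [triNorm_eq_max] at hvN' hwn'
      omega
    · rw [not_le] at hvn
      have := hvout hvn
      omega

/-- **The fence of an open crossing at an internal extremity** (Nolin's inner free space, on one
scale). Let `c` be a crossing of `intDom m` (`m ≥ 5`) with tip `z = (m, t)`,
`-m + 2k + 1 ≤ t ≤ -(2k+1)`, `1 ≤ k`, open in `ω`; let `ω'` agree with `ω` off `lower c z` and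
contain the open frame at scale `k` about `z`. Then in `ω`: the box `[m-2k, m-k] × [t+k, t+2k]`
(inside `Λ̊_m`) is crossed vertically by open sites through a site `mm`, and `mm` is joined to a
site of `c` by an open path in `intFrameZone m z k`. Twin of `trap_exists_fence`. [cite: Nolin2008, §4.4 Lemma 15 (proof) (arXiv 0711.4948: Lemma 14)] -/
theorem int_exists_fence (hm : 5 ≤ m) (hk : 1 ≤ k) (hc : (intDom m).IsCrossing c z)
    (htk : -(m : ℤ) + 2 * k + 1 ≤ z 1 ∧ z 1 ≤ -(2 * (k : ℤ) + 1))
    {ω ω' : SiteConfig (Site 2)} (hcω : (↑c : Set (Site 2)) ⊆ ω)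
    (hagree : ∀ v, v ∉ (intDom m).lower c z → (v ∈ ω' ↔ v ∈ ω)) (hframe : ω' ∈ triFrameAt z k) :
    ∃ mm : Site 2, OpenVCrossThrough (triStrip (z 0 - 2 * k) (z 1 + k) k k) (z 1 + k) (z 1 + 2 * k) ω mm ∧
      ∃ s ∈ c, PathIn triGraph (intFrameZone m z k ∩ ω) s mm := by
  have hk' : (1 : ℤ) ≤ k := by exact_mod_cast hk
  have hzJ := tip_isIntJ hc
  unfold IsIntJ at hzJ
  obtain ⟨hz0, hz1, hz2⟩ := hzJ
  obtain ⟨F⟩ := nonempty_frameData hframe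
  -- sites off the half-annulus are off `lower c z`, hence carry the same colour in `ω`, `ω'`
  have hlowD : ∀ v ∈ (intDom m).lower c z, v ∈ haFin m := fun v hv => JDomain.lower_subset_D hc.subset hv
  have hinn : ∀ v : Site 2, triNorm v < m → (v ∈ ω' ↔ v ∈ ω) := by
    intro v hv
    refine hagree v fun h => ?_
    have := (mem_haFin.1 (hlowD v h)).2.1
    omega
  -- the left strip is inside the inner half-hexagon
  have hWinn : ∀ v : Site 2, z 0 - 2 * k ≤ v 0 → v 0 ≤ z 0 - k → z 1 - 2 * k ≤ v 1 → v 1 ≤ z 1 + 2 * k →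
      triNorm v < m := by
    intro v h1 h2 h3 h4
    rw [triNorm_eq_max]; omega
  -- the upper part of the left crossing: a vertical crossing `V'` of the fence box
  obtain ⟨e₁, e₂, he₁, he₂, hV⟩ := F.pathW.exists_slab_crossing 1 (L := z 1 + k) (R := z 1 + 2 * k)
    (by omega) (by rw [F.xW1]; omega) (by rw [F.yW1])
  obtain ⟨SV, hSV, pV, tV⟩ := hV.exists_support
  have hSVb : ∀ v ∈ SV, z 0 - 2 * k ≤ v 0 ∧ v 0 ≤ z 0 - k ∧ z 1 + k ≤ v 1 ∧ v 1 ≤ z 1 + 2 * k := by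
    intro v hv
    have h1 := F.boundsW (hSV hv).1
    have h2 := (hSV hv).2
    simp only [Set.mem_setOf_eq] at h2
    omega
  have hSVω : SV ⊆ triStrip (z 0 - 2 * k) (z 1 + k) k k ∩ ω := by
    intro v hv
    have hb := hSVb v hv
    refine ⟨?_, (hinn v (hWinn v hb.1 hb.2.1 (by omega) hb.2.2.2)).1 ((F.SW_sub (hSV hv).1).2)⟩
    rw [mem_triStrip]; omega
  -- the top crossing meets `V'` at `mm`
  obtain ⟨mm, hmN, hmV⟩ := PathIn.tri_crossings_meet (L := z 0 - 2 * k) (R := z 0 + 2 * k)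
    (B := z 1 + k) (T := z 1 + 2 * k) (fun v hv => by have := F.boundsN hv; omega)
    (fun v hv => by have := hSVb v hv; omega) F.pathN F.xN0 F.yN0 pV he₁ he₂
  refine ⟨mm, ⟨e₁, e₂, he₁, he₂, (tV mm hmV).mono hSVω, ((tV mm hmV).symm.trans pV).mono hSVω⟩, ?_⟩
  -- `c` meets `Yr`: its start is outside the outer box, its tip is the centre
  have hmY : mm ∈ F.Yr := Or.inl (Or.inl hmN)
  obtain ⟨f, hfc, hfF⟩ := hc.exists_start
  have hfout : f 0 ≤ z 0 - 2 * k ∨ z 0 + 2 * k ≤ f 0 ∨ f 1 ≤ z 1 - 2 * k ∨ z 1 + 2 * k ≤ f 1 := by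
    obtain ⟨hf, hfF'⟩ := mem_intDom_F.1 hfF
    obtain ⟨hf0, -, hfN⟩ := mem_haFin.1 hf
    rcases hfF' with h | h
    · left; omega
    · rw [triNorm_eq_max] at h; omega
  obtain ⟨y, hyc, hyK⟩ := F.exists_mem_K hk (s := z) (t := f) (by omega) hfout (hc.conn z hc.tip_mem f hfc)
  have hyc' : y ∈ c := Finset.mem_coe.1 hyc
  have hyY : y ∈ F.Yr := by
    rcases hyK with ((hy | hy) | hy) | hy
    · exact Or.inl (Or.inl hy)
    · exact Or.inl (Or.inr hy)
    · exfalso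
      have hb := F.boundsW hy
      have h1 := (mem_haFin.1 (hc.subset hyc')).2.1
      have h2 := hWinn y hb.1 hb.2.1 hb.2.2.1 hb.2.2.2
      omega
    · exact Or.inr hy
  -- follow `Yr` from `mm` to the first site adjacent to `c`
  have hminn : triNorm mm < m := hWinn mm (hSVb mm hmV).1 (hSVb mm hmV).2.1 (by have := hSVb mm hmV; omega)
    (hSVb mm hmV).2.2.2
  have hmc : mm ∈ (↑c : Set (Site 2))ᶜ := fun h => by
    have := (mem_haFin.1 (hc.subset (Finset.mem_coe.1 h))).2.1; omega
  obtain ⟨p, q, hpc, hqc, hqY, hpq, hmp⟩ := (F.pathIn_Yr hk hmY hyY).exit (R := (↑c : Set (Site 2))ᶜ) hmc (fun h => h hyc)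
  have hqc' : q ∈ c := Finset.mem_coe.1 (not_not.1 hqc)
  have hmp' : PathIn triGraph (F.Yr \ ↑c) mm p := hmp.mono fun v hv => ⟨hv.2, hv.1⟩
  -- the invariant along this path
  set G : Set (Site 2) := {v | ((m : ℤ) ≤ triNorm v → v ∈ (intDom m).above c z) ∧
      (triNorm v < m → z 1 < v 1)} with hG
  have hmG : mm ∈ G := ⟨fun h => absurd hminn (not_lt.2 h), fun _ => by have := (hSVb mm hmV).2.2.1; omega⟩
  have hpath : PathIn triGraph ((F.Yr \ ↑c) ∩ G) mm p :=
    hmp'.inter_of_invariant hmG fun x w hx hxG hw hxw => int_invariant_step hm hk hc htk F hx hw hxw hxG.1 hxG.2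
  -- sites satisfying the invariant are open sites of the zone
  have hsub : (F.Yr \ ↑c) ∩ G ⊆ intFrameZone m z k ∩ ω := by
    rintro v ⟨⟨hvY, -⟩, hvin, hvout⟩
    have hb := F.boundsK (F.Yr_subset_K hvY)
    have hvω' : v ∈ ω' := F.K_subset (F.Yr_subset_K hvY)
    by_cases hvn : (m : ℤ) ≤ triNorm v
    · have hvD : v ∈ haFin m := by
        refine mem_haFin.2 ⟨by omega, hvn, ?_⟩
        rw [triNorm_eq_max]; omega
      refine ⟨⟨Or.inl (by rw [← coe_haFin]; exact Finset.mem_coe.2 hvD), by omega, by omega, by omega, by omega⟩, ?_⟩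
      have hva := hvin hvn
      have hvl : v ∉ (intDom m).lower c z := fun h =>
        ((JDomain.mem_lower_iff_not_mem_above (show v ∈ (intDom m).D from hvD)).1 h) hva
      exact (hagree v hvl).1 hvω'
    · rw [not_le] at hvn
      exact ⟨⟨Or.inr ⟨⟨by omega, hvn⟩, hvout hvn⟩, by omega, by omega, by omega, by omega⟩, (hinn v hvn).1 hvω'⟩
  have hpZ : p ∈ intFrameZone m z k ∩ ω := (hpath.mono hsub).right_mem
  have hqZ : q ∈ intFrameZone m z k ∩ ω := by
    have hb := F.boundsK (F.Yr_subset_K hqY)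
    exact ⟨⟨Or.inl (mem_haSet_of_mem_crossing hc hqc'), by omega, by omega, by omega, by omega⟩,
      hcω (Finset.mem_coe.2 hqc')⟩
  exact ⟨q, hqc', (PathIn.of_adj hqZ hpZ hpq.symm).trans (hpath.mono hsub).symm⟩

end Fence

end Literature.Probability.Percolation
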